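import Mathlib
import Summits.AnomalousDissipation.AnomalousDissipation.Theses.DyadicWallCascade
import Literature.Uncategorized.SteadyNSRealAnalytic
import Summits.AnomalousDissipation.AnomalousDissipation.Theorems.DyadicRealisation.Negative.WallProfileExistsFalseOfSteadyNSRealAnalytic
import Summits.AnomalousDissipation.AnomalousDissipation.Theorems.DyadicRealisation.Negative.ViscousWallProfileFalseOfLiouvilleConjectureNS
import Summits.AnomalousDissipation.AnomalousDissipation.Theorems.ViscousContinuation.Negative.NoExactFarFieldMatching

/-!
# Disproof of `ViscousContinuation` — findings (cdisprove seat, cycle 1, 2026-08-17, v2)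

Crux item stmt-AnomalousDissipation-17917, decl
`Summit.AnomalousDissipation.AnomalousDissipation.Theses.DyadicWallCascade.ViscousContinuation`,
route `DyadicWallCascade` (rev 2).  Everything below is kernel-checked unless marked `sorry`
(§5 only: the open Liouville statement and the new rate obstruction, paper-proved).

## Verdict of cycle 1: NO KILL — with checked reasons why none is cheap

## Index of findings

* §1 REFUTATION CALCULUS.  The crux is, by `Iff.rfl`, `HalfSpaceHierarchy → ViscousWallProfile`
  (its conclusion RE-QUANTIFIES the hierarchy), and `ViscousWallProfile → HalfSpaceHierarchy` by
  projection, so `¬ ViscousContinuation ↔ (HalfSpaceHierarchy ∧ ¬ ViscousWallProfile)`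
  (`not_viscousContinuation_iff`): an unconditional kill must PROVE the open crux #2 and a Liouville
  theorem for the profile class (support item stmt-17919).  Modulo the tree's canonical KNSS
  Liouville conjecture (L) (`LiouvilleConjectureNS`, via the sibling disprover's landed
  `ViscousWallProfile_false_of_LiouvilleConjectureNS`, p146507) the crux is EQUIVALENT to the
  negation of its own hypothesis: `viscousContinuation_iff_not_halfSpaceHierarchy_of_L`.  So the
  route's cruxes #2 and #3 are jointly satisfiable only if (L) fails in the steady mirror class.
* §2 LOAD-BEARING CLAUSES of the conclusion: dropping the blow-down clause, or `F ≠ 0` of the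
  conclusion's hierarchy block, makes the crux provable by zero witnesses
  (`viscousContinuationWithoutBlowdown_holds`, `viscousContinuationWithoutFluxNeZero_holds`).  No
  other single clause (mirror symmetry, pressure bound, the NS system, smoothness) could be shown
  load-bearing: deleting it leaves crux #2 + a Liouville counterexample inside (recorded, not proved).
* §3 REFUTED STRENGTHENINGS — LANDED (p146569,
  `Theorems/ViscousContinuation/Negative/NoExactFarFieldMatching.lean`, unconditional since the tree
  PROVES `SteadyNSRealAnalytic_holds`):
  - `not_viscousWallProfileExactAtSomeLevel` ← tree `energyFlux_eq_zero_of_exactLevel_blowdown`: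
    the blow-down cannot be EXACT at any single level `m` (`W (2^m •) = V` on the band ⇒ `2^m eᵢ`
    are periods of `W` on an open slab ⇒ everywhere by analyticity ⇒ `V` horizontally constant ⇒
    `F = 0`).  For the provers: `W ≠ V` on every dyadic band, the matching layer is infinitely
    thick; `viscousContinuationExactAtSomeLevel_iff_not_halfSpaceHierarchy`.
  - `not_viscousWallProfileSelfSimilar` ← tree `energyFlux_eq_zero_of_two_smul_invariant`: the
    profile is not itself discretely self-similar (continuity at the origin collapses it).
  - `not_viscousWallProfileEqOnHalfSpace` ← tree `energyFlux_eq_zero_of_eq_on_halfSpace`: `W ≠ V`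
    somewhere above the wall.
* §4 TARGETS — line `Sketch` (PICKED 2026-08-17T06:48Z; 7 registered stubs).  Verdict per stub:
  - `stub_farFieldWallProfile` (XL, the frontier): a COSTUME of the support item, certified here —
    `farFieldWallProfile_iff_viscousWallProfile` (its conclusion ↔ `ViscousWallProfile`, via
    `farField_of_blowDown` / `blowDown_of_farField`), `stubFarFieldWallProfile_of_viscousContinuation`
    (crux ⇒ stub, so the stub is NOT harder than the crux; the skeleton's chain gives the converse
    modulo the two flank stubs), and `stubFarFieldWallProfile_iff_of_L` (modulo (L) the stub holds
    iff its own seed hypothesis is EMPTY).  No cheaper kill than for the crux itself.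
  - `stub_blowDownOfFarField` (S): TRUE — proved here as `blowDown_of_farField` (candidate proof
    for the prover; not mine to land).
  - `stub_fluxNeg` (M): TRUE by `(V, Q, F) ↦ (-V, Q, -F)` (steady Euler is reversible, mass flux
    stays `0`); no attack surface.  Its conclusion implies `HalfSpaceHierarchy`
    (`halfSpaceHierarchy_of_negFluxHierarchy`, trivial direction, checked).
  - `stub_saintVenant` (toy): TRUE ((i) `R ↦ y R · exp (-R/c)` is non-decreasing on `[R₀, ∞)`;
    (ii) apply (i) from every base point `R' ≥ R₀` against the sub-exponential bound).  Junk
    values of `deriv` are excluded by `DifferentiableOn` on the OPEN ray.  No attack surface.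
  - `stub_lapRecursionSeries`, `stub_lapRecursionLipschitz`, `stub_doublingTransferContracts`
    (toys): TRUE (geometric series with ratio ½; `tsum` junk excluded by the boundedness
    hypothesis; an empty `α` makes everything vacuous consistently).  No attack surface.
  JOINT SUFFICIENCY: `ViscousContinuation_of` composes fluxNeg → farField → blowDown with no gap
  (kernel-checked modulo stubs); the whole crux sits inside `stub_farFieldWallProfile`.
* §5 NEAR-MISSES (sorried): `not_viscousWallProfileFastBlowDown` — NEW: the blow-down cannot be
  faster than the viscous rate `2^{-m}` (fast rate ⇒ `V` weakly harmonic on the band ⇒ on `H` ⇒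
  constant ⇒ `F = 0`; paper proof in the docstring, formalisation blocked only by harmonic unique
  continuation on `ℝ³`), a constraint on the dichotomy multiplier (`≥ 1/2`) of the line
  LevelMapDichotomy; and `viscousWallProfile_false` — the Liouville statement itself.  OPEN:
  bounded, non-decaying, infinite Dirichlet integral, 3-D, mirror plane only.  Every tree / printed
  Liouville theorem needs decay (Galdi `L^{9/2}`, Chae–Wolf, Seregin 2016 `L⁶ ∩ BMO⁻¹`,
  Bang–Yang 2024 arXiv:2402.11144 Thm 1.1: potential oscillation `≲ R^{(s+6)/3s}` — ours is `~R`),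
  2-D, axisymmetry (KNSS 2009, KPR 2015, Wang–Yang 2026), helical symmetry or a slab
  (Bang–Gui–Wang–Xie arXiv:2205.13259, Han–Wang–Xie arXiv:2312.10382).  The sign/stress
  normalisations `F < 0`, `⟨V₂V_h⟩ = 0` are registered PROVER stubs of the sibling crux
  (stmt-17918: `stub_fluxSign`, `stub_zeroStress`) — not duplicated here; paper proof recorded in
  the docstring of `viscousWallProfile_false` (telescoping horizontal cutoff: no horizontal mean of
  the aperiodic `W` is ever needed, answering NegativeNotes-r1-k1 §N4).

WHY IT RESISTS (for the provers): (i) logically, ¬crux needs crux #2; (ii) analytically, the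
conclusion is a counterexample to the steady bounded (KNSS) Liouville conjecture, and every EXACT
structure one might build into a construction (a period, exact matching at a level, exact
self-similarity, `W = V` near infinity) is refuted in §3: any proof must produce a genuinely
aperiodic `W` with `W ≠ V` on every band and `W - V → 0` only asymptotically.
-/

open scoped BigOperators Topology
open Filter Set MeasureTheory

-- the mandated namespace repeats `AnomalousDissipation` (single-problem summit)
set_option linter.dupNamespace false

namespace Summit.AnomalousDissipation.AnomalousDissipation.Cruxes.ViscousContinuation.Disproof

open Summit.AnomalousDissipation.AnomalousDissipation.Theses.DyadicWallCascade
open Summit.AnomalousDissipation.AnomalousDissipation.Theorems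
open Summit.AnomalousDissipation.AnomalousDissipation.Theorems.DyadicWallCascadeNegative

/-- Shorthand for `ℝ³`. -/
abbrev E3 : Type := EuclideanSpace ℝ (Fin 3)

/-! ## §0 The two clause blocks of the crux, verbatim, as predicates -/

/-- The half-space-hierarchy block (clauses of `HalfSpaceHierarchy`, verbatim). -/
def HierarchyBody (V : E3 → E3) (Q : E3 → ℝ) (C F : ℝ) : Prop :=
  let H : Set (EuclideanSpace ℝ (Fin 3)) := {X | 0 < X 2}
  let e : Fin 3 → EuclideanSpace ℝ (Fin 3) := fun i => EuclideanSpace.single i (1 : ℝ)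
  let pt : ℝ × ℝ → EuclideanSpace ℝ (Fin 3) := fun q => !₂[q.1, q.2, (1 : ℝ)]
  ContDiffOn ℝ ((⊤ : ℕ∞) : WithTop ℕ∞) V H ∧ ContDiffOn ℝ ((⊤ : ℕ∞) : WithTop ℕ∞) Q H ∧
  (∀ X ∈ H, ‖V X‖ ≤ C ∧ |Q X| ≤ C) ∧ (∀ X ∈ H, ∑ i : Fin 3, (fderiv ℝ V X (e i)) i = 0) ∧
  (∀ X ∈ H, (fderiv ℝ V X) (V X) + gradient Q X = 0) ∧
  (∀ X ∈ H, V ((2 : ℝ) • X) = V X ∧ Q ((2 : ℝ) • X) = Q X) ∧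
  (∀ X : EuclideanSpace ℝ (Fin 3), 1 ≤ X 2 → X 2 ≤ 2 →
    V (X + e 0) = V X ∧ V (X + e 1) = V X ∧ Q (X + e 0) = Q X ∧ Q (X + e 1) = Q X) ∧
  (∫ q in Set.Icc (0 : ℝ) 1 ×ˢ Set.Icc (0 : ℝ) 1, (V (pt q)) 2 = 0) ∧ F ≠ 0 ∧
  (∫ q in Set.Icc (0 : ℝ) 1 ×ˢ Set.Icc (0 : ℝ) 1, (V (pt q)) 2 * (‖V (pt q)‖ ^ 2 / 2 + Q (pt q)) = F)

/-- The clauses on `(W, P)` of `ViscousWallProfile` EXCEPT the last (blow-down) one, verbatim. -/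
def ViscousCore (W : E3 → E3) (P : E3 → ℝ) (C' : ℝ) : Prop :=
  let e : Fin 3 → EuclideanSpace ℝ (Fin 3) := fun i => EuclideanSpace.single i (1 : ℝ)
  let σ : EuclideanSpace ℝ (Fin 3) → EuclideanSpace ℝ (Fin 3) := fun X => X - (2 * X 2) • e 2
  ContDiff ℝ ((⊤ : ℕ∞) : WithTop ℕ∞) W ∧ ContDiff ℝ ((⊤ : ℕ∞) : WithTop ℕ∞) P ∧
  (∀ X, ‖W X‖ ≤ C' ∧ |P X| ≤ C') ∧ (∀ X, W (σ X) = σ (W X) ∧ P (σ X) = P X) ∧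
  (∀ X, ∑ i : Fin 3, (fderiv ℝ W X (e i)) i = 0) ∧
  (∀ X, (fderiv ℝ W X) (W X) + gradient P X = ∑ i : Fin 3, fderiv ℝ (fun Y => fderiv ℝ W Y (e i)) X (e i))

/-- The blow-down clause (last clause of `ViscousWallProfile`), verbatim. -/
def BlowDown (W : E3 → E3) (P : E3 → ℝ) (V : E3 → E3) (Q : E3 → ℝ) : Prop :=
  ∀ ε : ℝ, 0 < ε → ∃ M : ℕ, ∀ m : ℕ, M ≤ m → ∀ X : EuclideanSpace ℝ (Fin 3), 1 ≤ X 2 → X 2 ≤ 2 →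
    ‖W ((2 : ℝ) ^ m • X) - V X‖ ≤ ε ∧ |P ((2 : ℝ) ^ m • X) - Q X| ≤ ε

/-- The viscous block (the clauses on `(W, P)` of `ViscousWallProfile`, verbatim). -/
def ViscousBody (W : E3 → E3) (P : E3 → ℝ) (V : E3 → E3) (Q : E3 → ℝ) (C' : ℝ) : Prop :=
  let e : Fin 3 → EuclideanSpace ℝ (Fin 3) := fun i => EuclideanSpace.single i (1 : ℝ)
  let σ : EuclideanSpace ℝ (Fin 3) → EuclideanSpace ℝ (Fin 3) := fun X => X - (2 * X 2) • e 2
  ContDiff ℝ ((⊤ : ℕ∞) : WithTop ℕ∞) W ∧ ContDiff ℝ ((⊤ : ℕ∞) : WithTop ℕ∞) P ∧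
  (∀ X, ‖W X‖ ≤ C' ∧ |P X| ≤ C') ∧ (∀ X, W (σ X) = σ (W X) ∧ P (σ X) = P X) ∧
  (∀ X, ∑ i : Fin 3, (fderiv ℝ W X (e i)) i = 0) ∧
  (∀ X, (fderiv ℝ W X) (W X) + gradient P X = ∑ i : Fin 3, fderiv ℝ (fun Y => fderiv ℝ W Y (e i)) X (e i)) ∧
  (∀ ε : ℝ, 0 < ε → ∃ M : ℕ, ∀ m : ℕ, M ≤ m → ∀ X : EuclideanSpace ℝ (Fin 3), 1 ≤ X 2 → X 2 ≤ 2 →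
    ‖W ((2 : ℝ) ^ m • X) - V X‖ ≤ ε ∧ |P ((2 : ℝ) ^ m • X) - Q X| ≤ ε)

theorem halfSpaceHierarchy_iff : HalfSpaceHierarchy ↔ ∃ V Q C F, HierarchyBody V Q C F := Iff.rfl

theorem viscousWallProfile_iff :
    ViscousWallProfile ↔ ∃ W P V Q C F C', HierarchyBody V Q C F ∧ ViscousBody W P V Q C' := Iff.rfl

/-- `ViscousBody` = `ViscousCore` + `BlowDown` (re-association of the conjunction). -/
theorem viscousBody_iff (W : E3 → E3) (P : E3 → ℝ) (V : E3 → E3) (Q : E3 → ℝ) (C' : ℝ) :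
    ViscousBody W P V Q C' ↔ ViscousCore W P C' ∧ BlowDown W P V Q := by
  constructor
  · rintro ⟨h1, h2, h3, h4, h5, h6, h7⟩; exact ⟨⟨h1, h2, h3, h4, h5, h6⟩, h7⟩
  · rintro ⟨⟨h1, h2, h3, h4, h5, h6⟩, h7⟩; exact ⟨h1, h2, h3, h4, h5, h6, h7⟩

/-! ## §1 Refutation calculus of the crux -/

/-- The crux is the implication between the two other items of its own route. -/
theorem viscousContinuation_iff : ViscousContinuation ↔ (HalfSpaceHierarchy → ViscousWallProfile) :=
  Iff.rfl

/-- The conclusion of the crux already contains its hypothesis. -/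
theorem viscousWallProfile_imp_halfSpaceHierarchy : ViscousWallProfile → HalfSpaceHierarchy := by
  rw [viscousWallProfile_iff, halfSpaceHierarchy_iff]
  rintro ⟨W, P, V, Q, C, F, C', hH, -⟩
  exact ⟨V, Q, C, F, hH⟩

/-- Hence the crux is an `↔` in disguise. -/
theorem viscousContinuation_iff_iff : ViscousContinuation ↔ (HalfSpaceHierarchy ↔ ViscousWallProfile) :=
  ⟨fun h => ⟨h, viscousWallProfile_imp_halfSpaceHierarchy⟩, fun h => h.mp⟩

/-- **What a refutation of the crux must contain**: a proof of crux #2 and a Liouville theorem for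
the profile class. -/
theorem not_viscousContinuation_iff :
    ¬ ViscousContinuation ↔ (HalfSpaceHierarchy ∧ ¬ ViscousWallProfile) := by
  rw [viscousContinuation_iff, Classical.not_imp]

/-- Conversely a refutation of crux #2 PROVES this crux (vacuously). -/
theorem viscousContinuation_of_not_halfSpaceHierarchy (h : ¬ HalfSpaceHierarchy) : ViscousContinuation :=
  fun h2 => (h h2).elim

/-- **Modulo the KNSS Liouville conjecture (L) the crux is the negation of its own hypothesis**
(sibling disprover's landed `ViscousWallProfile_false_of_LiouvilleConjectureNS`, p146507, + §1):
under (L) a prover can close the crux only by refuting crux #2, and the route's `closes h₂ h₃ h₄` can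
be instantiated only if (L) fails for a steady mirror-symmetric pressure-bounded flow. -/
theorem viscousContinuation_iff_not_halfSpaceHierarchy_of_L
    (hL : Summit.NavierStokesRegularity.NavierStokesRegularity.LiouvilleConjectureNS) :
    ViscousContinuation ↔ ¬ HalfSpaceHierarchy :=
  ⟨fun h h2 => ViscousWallProfile_false_of_LiouvilleConjectureNS hL (h h2), fun h h2 => (h h2).elim⟩

/-! ## §2 Load-bearing clauses of the conclusion (zero witnesses once a clause is dropped) -/

/-- The crux with the blow-down clause deleted from its conclusion. -/
def ViscousContinuationWithoutBlowdown : Prop :=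
  HalfSpaceHierarchy → ∃ (W : E3 → E3) (P : E3 → ℝ) (V : E3 → E3) (Q : E3 → ℝ) (C F C' : ℝ),
    HierarchyBody V Q C F ∧ ViscousCore W P C'

/-- Without the blow-down clause the crux is settled by the fluid at rest: the blow-down clause is
the ONLY link between `W` and `V` (load-bearing). -/
theorem viscousContinuationWithoutBlowdown_holds : ViscousContinuationWithoutBlowdown := by
  intro h2
  obtain ⟨V, Q, C, F, hH⟩ := halfSpaceHierarchy_iff.mp h2
  refine ⟨fun _ => 0, fun _ => 0, V, Q, C, F, 0, hH, ?_⟩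
  exact ⟨contDiff_const, contDiff_const, fun X => by simp, fun X => by simp, fun X => by simp,
    fun X => by simp⟩

/-- The crux with `F ≠ 0` deleted from the conclusion's hierarchy block (it stays in the
hypothesis). -/
def ViscousContinuationWithoutFluxNeZero : Prop :=
  HalfSpaceHierarchy → ∃ (W : E3 → E3) (P : E3 → ℝ) (V : E3 → E3) (Q : E3 → ℝ) (C F C' : ℝ),
    let H : Set (EuclideanSpace ℝ (Fin 3)) := {X | 0 < X 2}
    let e : Fin 3 → EuclideanSpace ℝ (Fin 3) := fun i => EuclideanSpace.single i (1 : ℝ)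
    let pt : ℝ × ℝ → EuclideanSpace ℝ (Fin 3) := fun q => !₂[q.1, q.2, (1 : ℝ)]
    (ContDiffOn ℝ ((⊤ : ℕ∞) : WithTop ℕ∞) V H ∧ ContDiffOn ℝ ((⊤ : ℕ∞) : WithTop ℕ∞) Q H ∧
    (∀ X ∈ H, ‖V X‖ ≤ C ∧ |Q X| ≤ C) ∧ (∀ X ∈ H, ∑ i : Fin 3, (fderiv ℝ V X (e i)) i = 0) ∧
    (∀ X ∈ H, (fderiv ℝ V X) (V X) + gradient Q X = 0) ∧
    (∀ X ∈ H, V ((2 : ℝ) • X) = V X ∧ Q ((2 : ℝ) • X) = Q X) ∧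
    (∀ X : EuclideanSpace ℝ (Fin 3), 1 ≤ X 2 → X 2 ≤ 2 →
      V (X + e 0) = V X ∧ V (X + e 1) = V X ∧ Q (X + e 0) = Q X ∧ Q (X + e 1) = Q X) ∧
    (∫ q in Set.Icc (0 : ℝ) 1 ×ˢ Set.Icc (0 : ℝ) 1, (V (pt q)) 2 = 0) ∧
    (∫ q in Set.Icc (0 : ℝ) 1 ×ˢ Set.Icc (0 : ℝ) 1, (V (pt q)) 2 * (‖V (pt q)‖ ^ 2 / 2 + Q (pt q)) = F)) ∧
    ViscousBody W P V Q C'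

/-- Without `F ≠ 0` in the conclusion the crux is settled by zero fields throughout (load-bearing;
the hypothesis is not even used). -/
theorem viscousContinuationWithoutFluxNeZero_holds : ViscousContinuationWithoutFluxNeZero := by
  intro _
  refine ⟨fun _ => 0, fun _ => 0, fun _ => 0, fun _ => 0, 0, 0, 0, ?_, ?_⟩
  · refine ⟨contDiffOn_const, contDiffOn_const, fun X _ => by simp, fun X _ => by simp,
      fun X _ => by simp, fun X _ => by simp, fun X _ _ => by simp, by simp, by simp⟩
  · refine ⟨contDiff_const, contDiff_const, fun X => by simp, fun X => by simp, fun X => by simp,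
      fun X => by simp, fun ε hε => ⟨0, fun m _ X _ _ => by simp [hε.le]⟩⟩

/-! ## §3 Refuted strengthenings (unconditional; the clause-level engines are LANDED, p146569) -/

/-- Differentiability of the hierarchy on the open half-space (bookkeeping). -/
theorem differentiableAt_of_hierarchy {V : E3 → E3}
    (hVs : ContDiffOn ℝ ((⊤ : ℕ∞) : WithTop ℕ∞) V {X : E3 | 0 < X 2})
    (X : E3) (hX : 0 < X 2) : DifferentiableAt ℝ V X := by
  have hHopen : IsOpen {X : E3 | 0 < X 2} :=
    isOpen_lt continuous_const (PiLp.continuous_apply 2 (fun _ : Fin 3 => ℝ) (2 : Fin 3))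
  exact (hVs.differentiableOn (by simp) X hX).differentiableAt (hHopen.mem_nhds hX)

/-- STRENGTHENING 1 — exact far-field matching at one level: the profile block plus
`∃ m, ∀ X ∈ band, W (2^m • X) = V X`. -/
def ViscousWallProfileExactAtSomeLevel : Prop :=
  ∃ (W : E3 → E3) (P : E3 → ℝ) (V : E3 → E3) (Q : E3 → ℝ) (C F C' : ℝ),
    (HierarchyBody V Q C F ∧ ViscousBody W P V Q C') ∧
    ∃ m : ℕ, ∀ X : E3, 1 ≤ X 2 → X 2 ≤ 2 → W ((2 : ℝ) ^ m • X) = V X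

/-- **Strengthening 1 is false** (tree: `energyFlux_eq_zero_of_exactLevel_blowdown`): no viscous
wall profile matches its hierarchy exactly at any single level of the blow-down. -/
theorem not_viscousWallProfileExactAtSomeLevel : ¬ ViscousWallProfileExactAtSomeLevel := by
  rintro ⟨W, P, V, Q, C, F, C', ⟨hH, hV⟩, m, hm⟩
  obtain ⟨hVs, hQs, hbdd, hdiv, hEul, hdil, hper, hmass, hF, hflux⟩ := hH
  obtain ⟨hWs, hPs, hWb, hmir, hWdiv, hNS, hbd⟩ := hV
  exact hF (energyFlux_eq_zero_of_exactLevel_blowdown hWs hPs hWdiv hNS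
    (fun X h1 h2 => ⟨(hper X h1 h2).1, (hper X h1 h2).2.1⟩)
    (fun ε hε => (hbd ε hε).imp fun M hM m hm X h1 h2 => (hM m hm X h1 h2).1) hm
    (differentiableAt_of_hierarchy hVs) hmass hflux)

/-- The crux with Strengthening 1 as conclusion … -/
def ViscousContinuationExactAtSomeLevel : Prop := HalfSpaceHierarchy → ViscousWallProfileExactAtSomeLevel

/-- … holds iff crux #2 FAILS: sharpening the blow-down clause to exact matching at one level turns
the crux into the negation of the route's own profile crux. -/
theorem viscousContinuationExactAtSomeLevel_iff_not_halfSpaceHierarchy :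
    ViscousContinuationExactAtSomeLevel ↔ ¬ HalfSpaceHierarchy :=
  ⟨fun h h2 => not_viscousWallProfileExactAtSomeLevel (h h2), fun h h2 => (h h2).elim⟩

/-- STRENGTHENING 2 — a discretely self-similar profile: the profile block plus
`∀ X, W (2 • X) = W X`. -/
def ViscousWallProfileSelfSimilar : Prop :=
  ∃ (W : E3 → E3) (P : E3 → ℝ) (V : E3 → E3) (Q : E3 → ℝ) (C F C' : ℝ),
    (HierarchyBody V Q C F ∧ ViscousBody W P V Q C') ∧ ∀ X : E3, W ((2 : ℝ) • X) = W X

/-- **Strengthening 2 is false** (tree: `energyFlux_eq_zero_of_two_smul_invariant`). -/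
theorem not_viscousWallProfileSelfSimilar : ¬ ViscousWallProfileSelfSimilar := by
  rintro ⟨W, P, V, Q, C, F, C', ⟨hH, hV⟩, hss⟩
  obtain ⟨hVs, hQs, hbdd, hdiv, hEul, hdil, hper, hmass, hF, hflux⟩ := hH
  obtain ⟨hWs, hPs, hWb, hmir, hWdiv, hNS, hbd⟩ := hV
  exact hF (energyFlux_eq_zero_of_two_smul_invariant hWs.continuous.continuousAt hss
    (fun ε hε => (hbd ε hε).imp fun M hM m hm X h1 h2 => (hM m hm X h1 h2).1) hmass hflux)

/-- STRENGTHENING 3 — the profile coincides with the hierarchy on the whole open half-space. -/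
def ViscousWallProfileEqOnHalfSpace : Prop :=
  ∃ (W : E3 → E3) (P : E3 → ℝ) (V : E3 → E3) (Q : E3 → ℝ) (C F C' : ℝ),
    (HierarchyBody V Q C F ∧ ViscousBody W P V Q C') ∧ ∀ X : E3, 0 < X 2 → W X = V X

/-- **Strengthening 3 is false** (tree: `energyFlux_eq_zero_of_eq_on_halfSpace`). -/
theorem not_viscousWallProfileEqOnHalfSpace : ¬ ViscousWallProfileEqOnHalfSpace := by
  rintro ⟨W, P, V, Q, C, F, C', ⟨hH, hV⟩, heq⟩
  obtain ⟨hVs, hQs, hbdd, hdiv, hEul, hdil, hper, hmass, hF, hflux⟩ := hH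
  obtain ⟨hWs, hPs, hWb, hmir, hWdiv, hNS, hbd⟩ := hV
  exact hF (energyFlux_eq_zero_of_eq_on_halfSpace hWs.continuous.continuousAt
    (fun X hX => (hdil X hX).1) heq hmass hflux)

/-! ## §4 Targets — line `Sketch` (Cruxes/ViscousContinuation/Lines/Sketch.lean, 7 stubs)

The frontier stub `stub_farFieldWallProfile` replaces the band blow-down clause by uniform
convergence as `z → +∞`.  The two forms are EQUIVALENT given the dilation invariance of `(V, Q)`
(which sits in the hierarchy block of both): `farField_of_blowDown`, `blowDown_of_farField`.  Hence
the stub's conclusion is the support item `ViscousWallProfile` in costume, the stub follows from the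
crux, and modulo (L) it is vacuous-or-false exactly like the crux. -/

/-- Iterated dilation invariance on the open half-space. -/
theorem dilate_pow {V : E3 → E3} {Q : E3 → ℝ}
    (hdil : ∀ X : E3, 0 < X 2 → V ((2 : ℝ) • X) = V X ∧ Q ((2 : ℝ) • X) = Q X) :
    ∀ (n : ℕ) (Y : E3), 0 < Y 2 → V ((2 : ℝ) ^ n • Y) = V Y ∧ Q ((2 : ℝ) ^ n • Y) = Q Y := by
  intro n
  induction n with
  | zero => intro Y _; simp
  | succ n ih =>
    intro Y hY
    have hpos : 0 < (((2 : ℝ) ^ n) • Y) 2 := by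
      simp only [PiLp.smul_apply, smul_eq_mul]; positivity
    rw [pow_succ, mul_comm, mul_smul, (hdil _ hpos).1, (hdil _ hpos).2]
    exact ih Y hY

/-- **Band blow-down ⇒ far-field convergence** (the converse transfer the lead asked for): if
`(V, Q)` is dilation invariant on the open half-space and `(W, P)(2^m •) → (V, Q)` uniformly on the
band, then `(W, P) - (V, Q) → 0` uniformly as `z → +∞`. [folklore] -/
theorem farField_of_blowDown {W V : E3 → E3} {P Q : E3 → ℝ}
    (hdil : ∀ X : E3, 0 < X 2 → V ((2 : ℝ) • X) = V X ∧ Q ((2 : ℝ) • X) = Q X)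
    (hbd : ∀ ε : ℝ, 0 < ε → ∃ M : ℕ, ∀ m : ℕ, M ≤ m → ∀ X : E3, 1 ≤ X 2 → X 2 ≤ 2 →
      ‖W ((2 : ℝ) ^ m • X) - V X‖ ≤ ε ∧ |P ((2 : ℝ) ^ m • X) - Q X| ≤ ε) :
    ∀ ε : ℝ, 0 < ε → ∃ Z : ℝ, ∀ X : E3, Z ≤ X 2 → ‖W X - V X‖ ≤ ε ∧ |P X - Q X| ≤ ε := by
  intro ε hε
  obtain ⟨M, hM⟩ := hbd ε hε
  refine ⟨(2 : ℝ) ^ M, fun X hX => ?_⟩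
  have h1X : 1 ≤ X 2 := le_trans (one_le_pow₀ (by norm_num)) hX
  obtain ⟨m, hm1, hm2⟩ := exists_nat_pow_near h1X (one_lt_two : (1 : ℝ) < 2)
  have hMm : M ≤ m := by
    by_contra h
    have h' : m + 1 ≤ M := by omega
    have : (2 : ℝ) ^ (m + 1) ≤ (2 : ℝ) ^ M := pow_le_pow_right₀ (by norm_num) h'
    linarith
  have h2m : (0 : ℝ) < (2 : ℝ) ^ m := by positivity
  set Y : E3 := ((2 : ℝ) ^ m)⁻¹ • X with hY
  have hY2 : Y 2 = ((2 : ℝ) ^ m)⁻¹ * X 2 := by simp [hY]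
  have hY1 : 1 ≤ Y 2 := by
    rw [hY2, ← div_eq_inv_mul, le_div_iff₀ h2m]; simpa using hm1
  have hY2' : Y 2 ≤ 2 := by
    rw [hY2, ← div_eq_inv_mul, div_le_iff₀ h2m]
    calc X 2 ≤ (2 : ℝ) ^ (m + 1) := hm2.le
      _ = 2 * 2 ^ m := by ring
  have hYpos : 0 < Y 2 := lt_of_lt_of_le one_pos hY1
  have hXY : X = (2 : ℝ) ^ m • Y := by
    rw [hY, smul_smul, mul_inv_cancel₀ h2m.ne', one_smul]
  obtain ⟨hW, hP⟩ := hM m hMm Y hY1 hY2'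
  obtain ⟨hVd, hQd⟩ := dilate_pow hdil m Y hYpos
  rw [hXY, hVd, hQd]
  exact ⟨hW, hP⟩

/-- **Far-field convergence ⇒ band blow-down** (= the content of `stub_blowDownOfFarField`;
candidate proof for the prover, recorded because the costume certificate needs both directions).
[folklore] -/
theorem blowDown_of_farField {W V : E3 → E3} {P Q : E3 → ℝ}
    (hdil : ∀ X : E3, 0 < X 2 → V ((2 : ℝ) • X) = V X ∧ Q ((2 : ℝ) • X) = Q X)
    (hfar : ∀ ε : ℝ, 0 < ε → ∃ Z : ℝ, ∀ X : E3, Z ≤ X 2 → ‖W X - V X‖ ≤ ε ∧ |P X - Q X| ≤ ε) :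
    ∀ ε : ℝ, 0 < ε → ∃ M : ℕ, ∀ m : ℕ, M ≤ m → ∀ X : E3, 1 ≤ X 2 → X 2 ≤ 2 →
      ‖W ((2 : ℝ) ^ m • X) - V X‖ ≤ ε ∧ |P ((2 : ℝ) ^ m • X) - Q X| ≤ ε := by
  intro ε hε
  obtain ⟨Z, hZ⟩ := hfar ε hε
  obtain ⟨M, hM⟩ := pow_unbounded_of_one_lt Z (one_lt_two : (1 : ℝ) < 2)
  refine ⟨M, fun m hm X h1 _ => ?_⟩
  have hXpos : 0 < X 2 := lt_of_lt_of_le one_pos h1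
  have hge : Z ≤ ((2 : ℝ) ^ m • X) 2 := by
    simp only [PiLp.smul_apply, smul_eq_mul]
    have h2 : (2 : ℝ) ^ M ≤ (2 : ℝ) ^ m := pow_le_pow_right₀ (by norm_num) hm
    nlinarith [hM.le, h2, pow_pos (two_pos : (0 : ℝ) < 2) m]
  obtain ⟨hW, hP⟩ := hZ _ hge
  obtain ⟨hVd, hQd⟩ := dilate_pow hdil m X hXpos
  rw [hVd] at hW; rw [hQd] at hP
  exact ⟨hW, hP⟩

/-- The conclusion of `stub_farFieldWallProfile`, VERBATIM (local notation `E³` expanded). -/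
def FarFieldWallProfile : Prop :=
  ∃ (W : E3 → E3) (P : E3 → ℝ) (V : E3 → E3) (Q : E3 → ℝ) (C F C' : ℝ),
    (ContDiffOn ℝ ((⊤ : ℕ∞) : WithTop ℕ∞) V {X : E3 | 0 < X 2} ∧
      ContDiffOn ℝ ((⊤ : ℕ∞) : WithTop ℕ∞) Q {X : E3 | 0 < X 2} ∧
      (∀ X : E3, 0 < X 2 → ‖V X‖ ≤ C ∧ |Q X| ≤ C) ∧
      (∀ X : E3, 0 < X 2 → ∑ i : Fin 3, (fderiv ℝ V X (EuclideanSpace.single i (1 : ℝ))) i = 0) ∧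
      (∀ X : E3, 0 < X 2 → (fderiv ℝ V X) (V X) + gradient Q X = 0) ∧
      (∀ X : E3, 0 < X 2 → V ((2 : ℝ) • X) = V X ∧ Q ((2 : ℝ) • X) = Q X) ∧
      (∀ X : E3, 1 ≤ X 2 → X 2 ≤ 2 →
        V (X + EuclideanSpace.single 0 (1 : ℝ)) = V X ∧ V (X + EuclideanSpace.single 1 (1 : ℝ)) = V X ∧
        Q (X + EuclideanSpace.single 0 (1 : ℝ)) = Q X ∧ Q (X + EuclideanSpace.single 1 (1 : ℝ)) = Q X) ∧
      (∫ q in Set.Icc (0 : ℝ) 1 ×ˢ Set.Icc (0 : ℝ) 1, (V !₂[q.1, q.2, (1 : ℝ)]) 2 = 0) ∧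
      F ≠ 0 ∧
      (∫ q in Set.Icc (0 : ℝ) 1 ×ˢ Set.Icc (0 : ℝ) 1,
        (V !₂[q.1, q.2, (1 : ℝ)]) 2 * (‖V !₂[q.1, q.2, (1 : ℝ)]‖ ^ 2 / 2 + Q !₂[q.1, q.2, (1 : ℝ)]) = F)) ∧
    ContDiff ℝ ((⊤ : ℕ∞) : WithTop ℕ∞) W ∧ ContDiff ℝ ((⊤ : ℕ∞) : WithTop ℕ∞) P ∧
    (∀ X, ‖W X‖ ≤ C' ∧ |P X| ≤ C') ∧
    (∀ X : E3, W (X - (2 * X 2) • EuclideanSpace.single 2 (1 : ℝ)) =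
        W X - (2 * W X 2) • EuclideanSpace.single 2 (1 : ℝ) ∧
      P (X - (2 * X 2) • EuclideanSpace.single 2 (1 : ℝ)) = P X) ∧
    (∀ X : E3, ∑ i : Fin 3, (fderiv ℝ W X (EuclideanSpace.single i (1 : ℝ))) i = 0) ∧
    (∀ X : E3, (fderiv ℝ W X) (W X) + gradient P X =
      ∑ i : Fin 3, fderiv ℝ (fun Y => fderiv ℝ W Y (EuclideanSpace.single i (1 : ℝ))) X
        (EuclideanSpace.single i (1 : ℝ))) ∧
    (∀ ε : ℝ, 0 < ε → ∃ Z : ℝ, ∀ X : E3, Z ≤ X 2 → ‖W X - V X‖ ≤ ε ∧ |P X - Q X| ≤ ε)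

/-- The seed hypothesis of `stub_farFieldWallProfile` (= conclusion of `stub_fluxNeg`), VERBATIM:
a half-space hierarchy with `F < 0`. -/
def NegFluxHierarchy : Prop :=
  ∃ (V : E3 → E3) (Q : E3 → ℝ) (C F : ℝ),
    ContDiffOn ℝ ((⊤ : ℕ∞) : WithTop ℕ∞) V {X : E3 | 0 < X 2} ∧
    ContDiffOn ℝ ((⊤ : ℕ∞) : WithTop ℕ∞) Q {X : E3 | 0 < X 2} ∧
    (∀ X : E3, 0 < X 2 → ‖V X‖ ≤ C ∧ |Q X| ≤ C) ∧
    (∀ X : E3, 0 < X 2 → ∑ i : Fin 3, (fderiv ℝ V X (EuclideanSpace.single i (1 : ℝ))) i = 0) ∧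
    (∀ X : E3, 0 < X 2 → (fderiv ℝ V X) (V X) + gradient Q X = 0) ∧
    (∀ X : E3, 0 < X 2 → V ((2 : ℝ) • X) = V X ∧ Q ((2 : ℝ) • X) = Q X) ∧
    (∀ X : E3, 1 ≤ X 2 → X 2 ≤ 2 →
      V (X + EuclideanSpace.single 0 (1 : ℝ)) = V X ∧ V (X + EuclideanSpace.single 1 (1 : ℝ)) = V X ∧
      Q (X + EuclideanSpace.single 0 (1 : ℝ)) = Q X ∧ Q (X + EuclideanSpace.single 1 (1 : ℝ)) = Q X) ∧
    (∫ q in Set.Icc (0 : ℝ) 1 ×ˢ Set.Icc (0 : ℝ) 1, (V !₂[q.1, q.2, (1 : ℝ)]) 2 = 0) ∧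
    F < 0 ∧
    (∫ q in Set.Icc (0 : ℝ) 1 ×ˢ Set.Icc (0 : ℝ) 1,
      (V !₂[q.1, q.2, (1 : ℝ)]) 2 * (‖V !₂[q.1, q.2, (1 : ℝ)]‖ ^ 2 / 2 + Q !₂[q.1, q.2, (1 : ℝ)]) = F)

/-- The statement of `stub_farFieldWallProfile`, as a `Prop`. -/
def StubFarFieldWallProfile : Prop := NegFluxHierarchy → FarFieldWallProfile

/-- **Costume certificate**: the frontier stub's conclusion IS the support item
`ViscousWallProfile` (the far-field clause and the band blow-down clause are interchangeable given
the dilation invariance in the hierarchy block). -/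
theorem farFieldWallProfile_iff_viscousWallProfile : FarFieldWallProfile ↔ ViscousWallProfile := by
  constructor
  · rintro ⟨W, P, V, Q, C, F, C', hH, hWs, hPs, hWb, hmir, hWdiv, hNS, hfar⟩
    refine ⟨W, P, V, Q, C, F, C', hH, hWs, hPs, hWb, hmir, hWdiv, hNS, ?_⟩
    exact blowDown_of_farField (fun X hX => hH.2.2.2.2.2.1 X hX) hfar
  · rintro ⟨W, P, V, Q, C, F, C', hH, hWs, hPs, hWb, hmir, hWdiv, hNS, hbd⟩
    refine ⟨W, P, V, Q, C, F, C', hH, hWs, hPs, hWb, hmir, hWdiv, hNS, ?_⟩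
    exact farField_of_blowDown (fun X hX => hH.2.2.2.2.2.1 X hX) hbd

/-- The seed is in particular a half-space hierarchy (trivial direction; the converse is the
prover's `stub_fluxNeg`, true by `V ↦ -V`). -/
theorem halfSpaceHierarchy_of_negFluxHierarchy : NegFluxHierarchy → HalfSpaceHierarchy := by
  rintro ⟨V, Q, C, F, h1, h2, h3, h4, h5, h6, h7, h8, hF, h10⟩
  exact ⟨V, Q, C, F, h1, h2, h3, h4, h5, h6, h7, h8, hF.ne, h10⟩

/-- **The frontier stub follows from the crux** (so it is not harder than the crux; with the
skeleton's own chain — `stub_fluxNeg`, `stub_blowDownOfFarField` — it is EQUIVALENT to it). -/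
theorem stubFarFieldWallProfile_of_viscousContinuation (h : ViscousContinuation) :
    StubFarFieldWallProfile := fun hseed =>
  farFieldWallProfile_iff_viscousWallProfile.mpr (h (halfSpaceHierarchy_of_negFluxHierarchy hseed))

/-- **Modulo (L) the frontier stub's conclusion is FALSE** … -/
theorem not_farFieldWallProfile_of_L
    (hL : Summit.NavierStokesRegularity.NavierStokesRegularity.LiouvilleConjectureNS) :
    ¬ FarFieldWallProfile := fun h =>
  ViscousWallProfile_false_of_LiouvilleConjectureNS hL (farFieldWallProfile_iff_viscousWallProfile.mp h)

/-- … hence modulo (L) the stub holds iff its seed hypothesis is empty (vacuity), i.e. iff crux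
#2 fails up to the sign normalisation. -/
theorem stubFarFieldWallProfile_iff_of_L
    (hL : Summit.NavierStokesRegularity.NavierStokesRegularity.LiouvilleConjectureNS) :
    StubFarFieldWallProfile ↔ ¬ NegFluxHierarchy :=
  ⟨fun h hs => not_farFieldWallProfile_of_L hL (h hs), fun h hs => (h hs).elim⟩

/-! ## §5 Near-miss (sorried; obstruction in the docstring) -/

/-- NEAR-MISS: the Liouville statement that kills the crux's mechanism (support item
stmt-AnomalousDissipation-17919).  OPEN: `W` is bounded, non-decaying (`W → V ≠ const`), has
infinite Dirichlet integral (`∫|∇W|² = |F|` per unit WALL AREA), is genuinely 3-D and has only a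
mirror plane; every Liouville theorem in the tree (`SteadyLiouvilleCriteria`, `galdi_liouville_nineHalves`,
`KNSS2009_liouville_planar/axisymmetric_no_swirl`, `sereginWang_liouville_L3_annulus`,
`KorobkovPileckasRusso2015_liouville_noSwirl`) or in print needs decay, 2-D, axisymmetry, helical
symmetry or a slab (module docstring §5).  Identities tried (all consistent, no kill): energy
(`F = -D/2`; rigorous WITHOUT horizontal means of the aperiodic `W`: test the localised energy
identity `IsLerayProfile.integral_mul_frobeniusNormSq_eq` for the rescaled solution
`2^m W(2^m ·), 4^m P(2^m ·)` against `ψ(X) = A_N(X₀) A_N(X₁) B(X₂)` with the TELESCOPING cutoff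
`A_N = S - S(· - N)` (`S` = `CubeShell.step`), for which `∫ A_N g = N ∫_0^1 g` EXACTLY for
`1`-periodic `g`, and `B` even, `= 1` on `[-1, 1]`, falling on `[1, 1+δ]`: the `Δψ` term is
`O(2^{-m})`, the lateral terms `O(N)`, the flux term `-2N² ∫_0^1 S'(τ) f̃(1 + δτ) dτ + O(εN²)` with
`f̃(s) = ∫_{[0,1]²} V₂H_V(q, s) dq → F` as `s → 1`; so `F > 0` is contradictory — this is the
sibling crux's `stub_fluxSign`), vertical momentum (`⟨V₂² + Q⟩ = ⟨P⟩|_{wall}`, free), horizontal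
momentum (`⟨V_h V₂⟩ = 0` — `stub_zeroStress` there), head maximum principle
(`(Δ - W·∇)(|W|²/2 + P) = |curl W|² ≥ 0`: ceiling only; the slab maximum principle with bounded
drift DOES hold — supersolution `cosh(εx₀)cosh(εx₁)(2e^{κZ} - 2cosh(κ X₂))`, `κ = 2 sup|W|` — so
the ideator's `HeadCeiling` is sound, no kill there either), analyticity (radius `O(1)` vs.
structure scale `~z`), lattice translates (a solenoid of profiles), quantitative unique
continuation from `z = ∞` (needs super-exponential agreement; no fixed shift is an asymptotic
period at ALL large heights, since the period of `V` coarsens upward). -/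
theorem viscousWallProfile_false : ¬ ViscousWallProfile := by
  sorry

/-- STRENGTHENING 4 — blow-down FASTER than the viscous rate: the profile block plus
`2^m · sup_band (‖W (2^m •) - V‖ + |P (2^m •) - Q|) → 0` (e.g. a geometric rate `θ^m` with
`θ < 1/2`, as an exponential dichotomy of the level map with stable multiplier `< 1/2` would give). -/
def ViscousWallProfileFastBlowDown : Prop :=
  ∃ (W : E3 → E3) (P : E3 → ℝ) (V : E3 → E3) (Q : E3 → ℝ) (C F C' : ℝ),
    (HierarchyBody V Q C F ∧ ViscousBody W P V Q C') ∧
    ∀ ε : ℝ, 0 < ε → ∃ M : ℕ, ∀ m : ℕ, M ≤ m → ∀ X : E3, 1 ≤ X 2 → X 2 ≤ 2 →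
      (2 : ℝ) ^ m * (‖W ((2 : ℝ) ^ m • X) - V X‖ + |P ((2 : ℝ) ^ m • X) - Q X|) ≤ ε

/-- NEAR-MISS (new finding of cycle 1; paper proof, NOT yet formalised): **the blow-down cannot
converge faster than the viscous rate `2^{-m}`** — every witness has
`sup_band (‖W(2^m •) - V‖ + |P(2^m •) - Q|) ≥ c · 2^{-m}` for some `c = c(V) > 0` and all large
`m`; in physical variables `sup_{Z ≤ z ≤ 2Z} (|W - V| + |P - Q|) ≳ 1/Z`.  Consequence for the line
LevelMapDichotomy / ProfileLimit: the stable multiplier of the linearised level map at `V` is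
`≥ 1/2`; the design rate `O(z^{-1/2})` (multiplier `2^{-1/2}`) is consistent, anything below `1/2`
is impossible; the profile remembers viscosity at order EXACTLY `1/z` (the size of `ΔV` at height
`z`).  Paper proof.  (1) Weak steady NS for the rescaled solution `U = 2^m W(2^m ·)`,
`Π = 4^m P(2^m ·)` tested against a smooth field `Φ` compactly supported in the open band
`S = {1 < X₂ < 2}` (tree IBP: `integral_inner_convect_add_eq_zero`,
`integral_inner_gradient_eq_neg_integral_mul_divergence`, `integral_inner_laplacian_add_eq_zero`):
`N_m + 2^{-m} L_m = 0` with `N_m = ∫⟨W_m, (W_m·∇)Φ⟩ + ∫ P_m div Φ`, `L_m = ∫⟨W_m, ΔΦ⟩`,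
`W_m = W(2^m ·)`, `P_m = P(2^m ·)`.  (2) Weak steady Euler for `(V, Q)` on `S` (IBP after a cutoff
extension `χ(X₂) V`, `χ = 1` near `[1,2]`, `tsupport χ ⊂ (0, ∞)`): `N_V = 0`.  (3)
`|N_m - N_V| ≤ K_Φ (C + C' + 1) · err_m`, so the fast rate along any subsequence gives
`L_V = ∫⟨V, ΔΦ⟩ = lim L_m = -lim 2^m N_m = 0` for every `Φ ∈ C_c^∞(S)`: `V` is weakly, hence
classically, harmonic on `S` (`IsOpen.ae_eq_zero_of_integral_contDiff_smul_eq_zero`), on the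
shifted band likewise, and by dilation covariance (`laplacian_comp_smul_apply`) on all of `H`.
(4) Harmonic endgame: `u = V(· + e₀) - V` is harmonic on the connected `H` and vanishes on `S`, so
`u ≡ 0` (unique continuation of harmonic functions); with dilation `V` has every horizontal period
`2^{-k} eᵢ` on `H`, hence `∂₀V = ∂₁V = 0` (tree `fderiv_apply_eq_zero_of_dyadic_periods`),
`V = v(X₂)` with `v'' = 0`, bounded on `(0, ∞)`, so `V` is constant and `F = 0`
(`energyFlux_eq_zero_of_const_trace`).  FORMALISATION BLOCKER: step (4) needs real-analyticity /
unique continuation of harmonic functions on `ℝ³`, absent from Mathlib (plane only,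
`Mathlib.Analysis.Complex.Harmonic.Analytic`) and from the tree (`HarmonicAnalyticContinuation.lean`
proves only analytic ⇒ harmonic-propagation); the substitute (Fourier series in `x, y` on the
periodic slab + ODE uniqueness for each mode) is ~1500 lines.  Steps (1)–(3) are tree-supported. -/
theorem not_viscousWallProfileFastBlowDown : ¬ ViscousWallProfileFastBlowDown := by
  sorry

end Summit.AnomalousDissipation.AnomalousDissipation.Cruxes.ViscousContinuation.Disproof
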